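import Summits.KontsevichZagierPeriods.KontsevichZagierPeriods.Theses.HurwitzMicroSectors
import Summits.KontsevichZagierPeriods.KontsevichZagierPeriods.Theorems.HurwitzMicroSectorsNormalFormPrinciplePiBoxTransfer
import Summits.KontsevichZagierPeriods.KontsevichZagierPeriods.Theorems.HurwitzMicroSectorsNormalFormPrincipleVariants2302

/-! TTRL-lite variant V2311 of stmt-KontsevichZagierPeriods-3869

Variant V2311 = `stub_boxRigidity` (the leaf `BoxRigidity` of `NormalFormPrinciple`: two representations
on open unit boxes with integrands of KZ's rational shape `p/q` over `ℚ` and equal values are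
KZ-equivalent) under the two-sided move `fix_nat:m=6; bound_nat:m'≤5` (left dimension frozen to `6`,
right dimension `≤ 5`). Verdict of the attempt seat: **open** — this file is the exact-strength
certificate, not a proof of the variant. Writing `BoxVanishing K` for "a box-rational representation of
dimension `K` and value `0` is a relation", the tree's graded lemmas of `…Variants2238`
(`boxVanishingDim_left_of_pair`: compare with the zero representation on the smaller box;
`boxRigidityLe_of_boxVanishingDim`: pad both representations to the `6`-box and subtract there, value `0`
by soundness) pin the variant exactly:
`V2311 ⟺ BoxVanishing 6 ⟺ BoxRigidity for all m, m' ≤ 6 ⟺ V2302` (`fix_nat:m=6; bound_nat:m'≤2`)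
(`stub_boxRigidity_var2311_iff_boxVanishing_six`, `…_iff_le_six`, `…_iff_var2302`); it yields
`BoxVanishing j` for every `j ≤ 6` (`boxVanishing_le_six_of_stub_boxRigidity_var2311`) and is implied by
`BoxVanishing 6` alone, by the parent leaf and by the Summit (`…_of_boxVanishing_six`, `…_of_parent`,
`…_of_statement`). Why open: `BoxVanishing 6 ⊇ BoxVanishing 5 ∋` "for `a b : ℚ`,
`a + b·ζ(5) = 0 ⇒ [a + b/(1 − x₁⋯x₅)]_{(0,1)⁵}` is a relation" (today only via `ζ(5) ∉ ℚ`, open),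
`⊇ BoxVanishing 3 ∋` the case split `ζ(3) ∈ ℚ + ℚπ²`, `⊇ BoxVanishing 2 ∋` Catalan's dichotomy; conversely
`KontsevichZagierPeriods → V2311`, so a refutation of the variant would refute the Summit, and the tree has
no additive invariant of `KZ.relations` finer than `KZ.eval`.
Source: M. Kontsevich, D. Zagier, *Periods* (2001), §1.2 Conjecture 1 and rules 1)–3). Pure proof file,
no definitions. -/

-- `Summit.<Summit>.<Problem>` is the tree's mandated summit-side namespace (CONVENTIONS §2); for this
-- single-conjunct summit the two coincide, so the duplicate is deliberate.
set_option linter.dupNamespace false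

noncomputable section

namespace Summit.KontsevichZagierPeriods.KontsevichZagierPeriods.Theorems

open MeasureTheory Set
open Literature.NumberTheory.Transcendental Literature.NumberTheory.Transcendental.KZ
open Summit.KontsevichZagierPeriods.KontsevichZagierPeriods.Theses.HurwitzMicroSectors
open Summit.KontsevichZagierPeriods.HurwitzMicroSectors.NormalFormPrinciple.PiBox

/-! ## The variant V2311 is exactly `BoxVanishing 6` -/

/-- **V2311 ⟺ `BoxVanishing 6`**: (⇒) the pair `(6, 0)` is allowed (`0 ≤ 5`), so compare a vanishing
box-rational representation on `(0,1)⁶` with the zero representation on the point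
(`boxVanishingDim_left_of_pair`); (⇐) `boxRigidityLe_of_boxVanishingDim 6` with `m = 6`, `m' ≤ 5 ≤ 6`.
[cite: KontsevichZagier2001, §1.2 Conjecture 1] -/
theorem stub_boxRigidity_var2311_iff_boxVanishing_six :
    (∀ (m' : ℕ) (N : IntegralRep 6) (N' : IntegralRep m'), m' ≤ 5 → N.domain = {x | ∀ i, x i ∈ Set.Ioo (0:ℝ) 1} → N.IsRational → N'.domain = {x | ∀ i, x i ∈ Set.Ioo (0:ℝ) 1} → N'.IsRational → N.value = N'.value → Equivalent N N') ↔
    (∀ (M : IntegralRep 6), M.domain = {x | ∀ i, x i ∈ Set.Ioo (0:ℝ) 1} → M.IsRational →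
      M.value = 0 → of M ∈ relations) :=
  ⟨fun h => boxVanishingDim_left_of_pair 6 0 fun N N' => h 0 N N' (Nat.zero_le 5),
    fun hvan m' N N' hm' =>
      boxRigidityLe_of_boxVanishingDim 6 hvan 6 m' N N' le_rfl (hm'.trans (by norm_num))⟩

/-- **V2311 ⟺ the sibling V2302** (`fix_nat:m=6; bound_nat:m'≤2`): both are `BoxVanishing 6`
(`stub_boxRigidity_var2302_iff_boxVanishing_six`). [cite: KontsevichZagier2001, §1.2 Conjecture 1] -/
theorem stub_boxRigidity_var2311_iff_var2302 :
    (∀ (m' : ℕ) (N : IntegralRep 6) (N' : IntegralRep m'), m' ≤ 5 → N.domain = {x | ∀ i, x i ∈ Set.Ioo (0:ℝ) 1} → N.IsRational → N'.domain = {x | ∀ i, x i ∈ Set.Ioo (0:ℝ) 1} → N'.IsRational → N.value = N'.value → Equivalent N N') ↔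
    (∀ (m' : ℕ) (N : IntegralRep 6) (N' : IntegralRep m'), m' ≤ 2 → N.domain = {x | ∀ i, x i ∈ Set.Ioo (0:ℝ) 1} → N.IsRational → N'.domain = {x | ∀ i, x i ∈ Set.Ioo (0:ℝ) 1} → N'.IsRational → N.value = N'.value → Equivalent N N') := by
  rw [stub_boxRigidity_var2311_iff_boxVanishing_six, stub_boxRigidity_var2302_iff_boxVanishing_six]

/-- **V2311 ⟺ `BoxRigidity` for all `m, m' ≤ 6`** (the honest strength of the variant: Conjecture 1 for
all pairs of rational integrands on the open unit boxes of dimension at most `6`; bounding `m' ≤ 5`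
rather than `≤ 6` loses nothing, by padding). [cite: KontsevichZagier2001, §1.2 Conjecture 1] -/
theorem stub_boxRigidity_var2311_iff_le_six :
    (∀ (m' : ℕ) (N : IntegralRep 6) (N' : IntegralRep m'), m' ≤ 5 → N.domain = {x | ∀ i, x i ∈ Set.Ioo (0:ℝ) 1} → N.IsRational → N'.domain = {x | ∀ i, x i ∈ Set.Ioo (0:ℝ) 1} → N'.IsRational → N.value = N'.value → Equivalent N N') ↔
    (∀ (m m' : ℕ) (N : IntegralRep m) (N' : IntegralRep m'), m ≤ 6 → m' ≤ 6 →
      N.domain = {x | ∀ i, x i ∈ Set.Ioo (0:ℝ) 1} → N.IsRational →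
      N'.domain = {x | ∀ i, x i ∈ Set.Ioo (0:ℝ) 1} → N'.IsRational →
      N.value = N'.value → Equivalent N N') := by
  rw [stub_boxRigidity_var2311_iff_var2302]
  exact stub_boxRigidity_var2302_iff_le_six

/-! ## Consequences downward, and the variant from above -/

/-- **V2311 ⇒ `BoxVanishing` in every dimension `j ≤ 6`** (monotonicity `boxVanishingDim_mono`: pad by
unit intervals), in particular the dimension-`5` statement about vanishing `ℚ`-combinations
`a + b·ζ(5)`. [cite: KontsevichZagier2001, §1.2 Conjecture 1] -/
theorem boxVanishing_le_six_of_stub_boxRigidity_var2311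
    (h : ∀ (m' : ℕ) (N : IntegralRep 6) (N' : IntegralRep m'), m' ≤ 5 → N.domain = {x | ∀ i, x i ∈ Set.Ioo (0:ℝ) 1} → N.IsRational → N'.domain = {x | ∀ i, x i ∈ Set.Ioo (0:ℝ) 1} → N'.IsRational → N.value = N'.value → Equivalent N N')
    {j : ℕ} (hj : j ≤ 6) :
    ∀ (M : IntegralRep j), M.domain = {x | ∀ i, x i ∈ Set.Ioo (0:ℝ) 1} → M.IsRational →
      M.value = 0 → of M ∈ relations :=
  boxVanishingDim_mono hj (stub_boxRigidity_var2311_iff_boxVanishing_six.1 h)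

/-- **`BoxVanishing 6` alone already proves V2311** (the honest residual of the variant, stated as the
missing lemma: whoever settles Conjecture 1 for vanishing box-rational periods of dimension `6` settles
V2311, and conversely). [cite: KontsevichZagier2001, §1.2 Conjecture 1] -/
theorem stub_boxRigidity_var2311_of_boxVanishing_six
    (hvan : ∀ (M : IntegralRep 6), M.domain = {x | ∀ i, x i ∈ Set.Ioo (0:ℝ) 1} → M.IsRational →
      M.value = 0 → of M ∈ relations) :
    ∀ (m' : ℕ) (N : IntegralRep 6) (N' : IntegralRep m'), m' ≤ 5 → N.domain = {x | ∀ i, x i ∈ Set.Ioo (0:ℝ) 1} → N.IsRational → N'.domain = {x | ∀ i, x i ∈ Set.Ioo (0:ℝ) 1} → N'.IsRational → N.value = N'.value → Equivalent N N' :=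
  stub_boxRigidity_var2311_iff_boxVanishing_six.2 hvan

/-- **The parent leaf ⇒ V2311** (specialisation `m := 6`, the bound `m' ≤ 5` is then idle; the
converse is not claimed — the parent is `BoxVanishing` in ALL dimensions).
[cite: KontsevichZagier2001, §1.2 Conjecture 1] -/
theorem stub_boxRigidity_var2311_of_parent
    (h : ∀ (m m' : ℕ) (N : IntegralRep m) (N' : IntegralRep m'), N.domain = {x | ∀ i, x i ∈ Set.Ioo (0:ℝ) 1} → N.IsRational → N'.domain = {x | ∀ i, x i ∈ Set.Ioo (0:ℝ) 1} → N'.IsRational → N.value = N'.value → Equivalent N N') :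
    ∀ (m' : ℕ) (N : IntegralRep 6) (N' : IntegralRep m'), m' ≤ 5 → N.domain = {x | ∀ i, x i ∈ Set.Ioo (0:ℝ) 1} → N.IsRational → N'.domain = {x | ∀ i, x i ∈ Set.Ioo (0:ℝ) 1} → N'.IsRational → N.value = N'.value → Equivalent N N' :=
  fun m' N N' _ => h 6 m' N N'

/-- **`KontsevichZagierPeriods ⇒ V2311`**: the variant is a special case of Conjecture 1 for the
tree's calculus (`leaves_of_statement`) — so a refutation of the variant would refute the Summit.
[cite: KontsevichZagier2001, §1.2 Conjecture 1] -/
theorem stub_boxRigidity_var2311_of_statement (h : _root_.KontsevichZagierPeriods) :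
    ∀ (m' : ℕ) (N : IntegralRep 6) (N' : IntegralRep m'), m' ≤ 5 → N.domain = {x | ∀ i, x i ∈ Set.Ioo (0:ℝ) 1} → N.IsRational → N'.domain = {x | ∀ i, x i ∈ Set.Ioo (0:ℝ) 1} → N'.IsRational → N.value = N'.value → Equivalent N N' :=
  stub_boxRigidity_var2311_of_parent (leaves_of_statement h).1

end Summit.KontsevichZagierPeriods.KontsevichZagierPeriods.Theorems

end
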